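import Summits.Ventures.PercRepro.SixThreeRule

/-!
# PercRepro — the soft max-trace rule at `(6, 3)`: the pair-witness bounds (p2, gen 6)

The inequality halves of mine-2's `MINE2-RLS.md` §19.2 Lemma S (b)/(c) for the planes-only rule of
`SixThreeRule.lean`: for `B ⊆ G` of rank `3` and `x ≠ x′ ∉ G`, with `S = B ∪ {x, x′}`,

* `pair_fibre_le`: the planes `P ≠ G` of `M|S` with `P ∩ B = L ∩ B` (a line `L` of `M|B`, `k = |L ∩ B|`) contribute at
  most `6^{k − 1}` to `D(S)` — one plane through `L ∪ {x, x′}` (trace `k + 2`) or at most two planes through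
  `L ∪ {x}`, `L ∪ {x′}` (trace `k + 1` each) — and at most `2 · 6^{k − 2}` when `ρ(S) = 5` (generic pair);
* `D_pair_le`: `D(S) ≤ 6^{|B| − 3} + 6 · Λ(B) + |B|` (the planes with `|P ∩ B| ≤ 1` are the `cl({a, x, x′})`,
  `a ∈ B`, of trace `3`);
* `D_pair_le_generic`: `D(S) ≤ 6^{|B| − 3} + 2 · Λ(B) + |B|` when `ρ(S) = 5`.
-/

namespace PercRepro

namespace SixThree

open Finset ThmH

variable {α : Type*} [DecidableEq α] {M : Matroid α} [M.Finite]

/-! ### Pair witnesses `S = B ∪ {x, x′}` -/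

/-- `S ∩ G = B` for `S = B ∪ {x, x′}` with `x, x′ ∉ G ⊇ B`. -/
theorem pair_inter_eq {G B : Finset α} {x x' : α} (hB : B ⊆ G) (hxG : x ∉ G) (hx'G : x' ∉ G) :
    (insert x (insert x' B)) ∩ G = B := by
  ext y
  rw [Finset.mem_inter, Finset.mem_insert, Finset.mem_insert]
  constructor
  · rintro ⟨rfl | rfl | hyB, hyG⟩
    · exact absurd hyG hxG
    · exact absurd hyG hx'G
    · exact hyB
  · intro hyB
    exact ⟨Or.inr (Or.inr hyB), hB hyB⟩

/-- The trace of `S = B ∪ {x, x′}` on `P` is `(P ∩ B) ∪ (P ∩ {x, x′})`. -/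
theorem pair_trace_eq (P B : Finset α) (x x' : α) :
    (insert x (insert x' B)) ∩ P = (P ∩ B) ∪ (P ∩ {x, x'}) := by
  ext y
  simp only [Finset.mem_inter, Finset.mem_insert, Finset.mem_union, Finset.mem_singleton]
  tauto

/-- `|S ∩ P| ≤ |P ∩ B| + |P ∩ {x, x′}|`. -/
theorem pair_trace_card_le (P B : Finset α) (x x' : α) :
    ((insert x (insert x' B)) ∩ P).card ≤ (P ∩ B).card + (P ∩ {x, x'}).card := by
  rw [pair_trace_eq]
  exact Finset.card_union_le _ _

/-- A plane `P ≠ G` with a rank-`3` trace on `S = B ∪ {x, x′}` meets `{x, x′}`. -/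
theorem pair_meets {G P B : Finset α} {x x' : α} (hG : G ∈ planes M) (hP : P ∈ planes M) (hne : P ≠ G)
    (hB : B ⊆ G) (hr3 : M.eRk (((insert x (insert x' B)) ∩ P : Finset α) : Set α) = 3) :
    (P ∩ {x, x'}).Nonempty := by
  by_contra h
  rw [Finset.not_nonempty_iff_eq_empty] at h
  have heq : (insert x (insert x' B)) ∩ P = P ∩ B := by
    rw [pair_trace_eq, h, Finset.union_empty]
  have hle2 := eRk_inter_le_two hG hP hne hB
  rw [heq] at hr3
  rw [hr3] at hle2
  exact absurd hle2 (by decide)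

/-- A point `y ∈ P ∩ {x, x′}` with `P ≠ G` a plane of rank-`2` trace `L ∩ B = P ∩ B` determines `P = cl(L ∪ {y})`. -/
theorem plane_eq_clF_insert (hs : Simple M) {G P L : Finset α} (hP : P ∈ planes M)
    (hL : L ∈ lines M) (hLP : L ⊆ P) (hLG : L ⊆ G) (hLcard : 2 ≤ L.card) {y : α} (hy : y ∈ gr M)
    (hyG : y ∉ G) (hyP : y ∈ P) : P = clF M (insert y L) := by
  have hyL : y ∉ L := fun h => hyG (hLG h)
  have hr3 : M.eRk ((insert y L : Finset α) : Set α) = 3 :=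
    eRk_insert_eq_three hs hL (Finset.Subset.refl _) hLcard hy hyL
  have hsub : insert y L ⊆ P := Finset.insert_subset hyP hLP
  have hclP := closure_eq_of_subset_plane hP hsub hr3
  apply Finset.coe_injective
  rw [coe_clF, hclP]

omit [M.Finite] in
/-- Submodularity in the form used for generic pairs: `ρ(B ∪ Z) ≤ ρ(B) + ρ(Z) − ρ(B ∩ Z)` with `ρ(B ∩ Z) ≥ 2`,
`ρ(B) = 3`, `ρ(Z) ≤ 3` gives `ρ(B ∪ Z) ≤ 4`. -/
theorem eRk_union_le_four {B Z : Finset α} (hrB : M.eRk (B : Set α) = 3) (hrZ : M.eRk (Z : Set α) ≤ 3)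
    (hrBZ : (2 : ℕ∞) ≤ M.eRk ((B ∩ Z : Finset α) : Set α)) : M.eRk ((B ∪ Z : Finset α) : Set α) ≤ 4 := by
  have h := M.eRk_inter_add_eRk_union_le (B : Set α) (Z : Set α)
  rw [← Finset.coe_inter, ← Finset.coe_union, hrB] at h
  have h2 : (2 : ℕ∞) + M.eRk ((B ∪ Z : Finset α) : Set α) ≤ 3 + 3 :=
    (add_le_add hrBZ (le_refl _)).trans (h.trans (add_le_add (le_refl _) hrZ))
  have h3 : (2 : ℕ∞) + M.eRk ((B ∪ Z : Finset α) : Set α) ≤ 2 + 4 := by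
    rw [show (2 : ℕ∞) + 4 = 3 + 3 by norm_num]; exact h2
  exact (ENat.add_le_add_iff_left (by decide)).1 h3

/-- **The fibre bound for pair witnesses, no-coplanar case.**  Fix `S = B ∪ {x, x′}` (`B ⊆ G` of rank `3`, `x ≠ x′ ∉ G`)
and a line `L` of `M|B` with `k = |L ∩ B|`.  If no plane `P ≠ G` with rank-`3` trace on `S` and `P ∩ B = L ∩ B` contains
both `x` and `x′`, those planes contain exactly one of `x, x′` (trace `k + 1`) and there are at most two of them
(`cl(L ∪ {x})`, `cl(L ∪ {x′})`): they contribute at most `2 · 6^{k − 2}` to `D(S)`. -/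
theorem pair_fibre_le_of_no_both (hs : Simple M) {G B L : Finset α} (hG : G ∈ planes M) (hB : B ⊆ G)
    (hL : L ∈ lines M) (hLG : L ⊆ G) (hLcard : 2 ≤ (L ∩ B).card)
    {x x' : α} (hx : x ∈ gr M) (hx' : x' ∈ gr M) (hxx' : x ≠ x') (hxG : x ∉ G) (hx'G : x' ∉ G)
    (F : Finset (Finset α))
    (hF : ∀ P ∈ F, P ∈ planes M ∧ P ≠ G ∧
      M.eRk (((insert x (insert x' B)) ∩ P : Finset α) : Set α) = 3 ∧ P ∩ B = L ∩ B ∧ L ⊆ P)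
    (hboth : ∀ P ∈ F, ¬ ({x, x'} : Finset α) ⊆ P) :
    ∑ P ∈ F, fRule M P (insert x (insert x' B)) ≤ 2 * (6 : ℚ) ^ ((L ∩ B).card - 2) := by
  classical
  have hLcard' : 2 ≤ L.card := hLcard.trans (Finset.card_le_card Finset.inter_subset_left)
  have hrule : ∀ P ∈ F, fRule M P (insert x (insert x' B)) =
      (6 : ℚ) ^ (((insert x (insert x' B)) ∩ P).card - 3) := by
    intro P hP
    unfold fRule
    rw [if_pos (hF P hP).2.2.1]
  have hclP : ∀ P ∈ F, ∀ y ∈ P ∩ {x, x'}, P = clF M (insert y L) := by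
    intro P hP y hy
    obtain ⟨hPpl, -, -, -, hLP⟩ := hF P hP
    rw [Finset.mem_inter, Finset.mem_insert, Finset.mem_singleton] at hy
    rcases hy with ⟨hyP, rfl | rfl⟩
    · exact plane_eq_clF_insert hs hPpl hL hLP hLG hLcard' hx hxG hyP
    · exact plane_eq_clF_insert hs hPpl hL hLP hLG hLcard' hx' hx'G hyP
  have hcardF : ∀ P ∈ F, ((insert x (insert x' B)) ∩ P).card ≤ (L ∩ B).card + (P ∩ {x, x'}).card := by
    intro P hP
    rw [← (hF P hP).2.2.2.1]
    exact pair_trace_card_le P B x x'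
  have hmeet : ∀ P ∈ F, (P ∩ {x, x'}).Nonempty := by
    intro P hP
    obtain ⟨hPpl, hne, hr3, -, -⟩ := hF P hP
    exact pair_meets hG hPpl hne hB hr3
  have hone : ∀ P ∈ F, (P ∩ {x, x'}).card ≤ 1 := by
    intro P hP
    by_contra h
    push Not at h
    have hsub : {x, x'} ⊆ P := by
      have hle : ({x, x'} : Finset α).card ≤ (P ∩ {x, x'}).card := by
        rw [Finset.card_pair hxx']; exact h
      exact (Finset.eq_of_subset_of_card_le Finset.inter_subset_right hle).symm ▸ Finset.inter_subset_left
    exact hboth P hP hsub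
  have hterm : ∀ P ∈ F, fRule M P (insert x (insert x' B)) ≤ (6 : ℚ) ^ ((L ∩ B).card - 2) := by
    intro P hP
    rw [hrule P hP]
    apply six_pow_le
    have := hcardF P hP
    have := hone P hP
    omega
  have hFsub : F ⊆ ({x, x'} : Finset α).image (fun y => clF M (insert y L)) := by
    intro P hP
    obtain ⟨y, hy⟩ := hmeet P hP
    rw [Finset.mem_image]
    exact ⟨y, (Finset.mem_inter.1 hy).2, (hclP P hP y hy).symm⟩
  have hcardF2 : F.card ≤ 2 := by
    calc F.card ≤ (({x, x'} : Finset α).image (fun y => clF M (insert y L))).card := Finset.card_le_card hFsub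
      _ ≤ ({x, x'} : Finset α).card := Finset.card_image_le
      _ = 2 := Finset.card_pair hxx'
  calc ∑ P ∈ F, fRule M P (insert x (insert x' B)) ≤ ∑ _P ∈ F, (6 : ℚ) ^ ((L ∩ B).card - 2) :=
        Finset.sum_le_sum hterm
    _ = (F.card : ℚ) * (6 : ℚ) ^ ((L ∩ B).card - 2) := by rw [Finset.sum_const, nsmul_eq_mul]
    _ ≤ 2 * (6 : ℚ) ^ ((L ∩ B).card - 2) := by
        apply mul_le_mul_of_nonneg_right _ (by positivity)
        exact_mod_cast hcardF2

/-- **The fibre bound for pair witnesses.**  Fix `S = B ∪ {x, x′}` (`B ⊆ G` of rank `3`, `x ≠ x′ ∉ G`) and a line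
`L` of `M|B` with `k = |L ∩ B|`.  The planes `P ≠ G` with rank-`3` trace on `S` and `P ∩ B = L ∩ B` contribute at most
`6^{k − 1}` to `D(S)`: either one plane contains `{x, x′}` (trace `k + 2`) or every such plane contains exactly one of
`x, x′` and there are at most two of them (trace `k + 1` each).  When `ρ(S) = 5` the first case is impossible and the
bound is `2 · 6^{k − 2}`. -/
theorem pair_fibre_le (hs : Simple M) {G B L : Finset α} (hG : G ∈ planes M) (hB : B ⊆ G)
    (hrB : M.eRk (B : Set α) = 3) (hL : L ∈ lines M) (hLG : L ⊆ G) (hLcard : 2 ≤ (L ∩ B).card)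
    {x x' : α} (hx : x ∈ gr M) (hx' : x' ∈ gr M) (hxx' : x ≠ x') (hxG : x ∉ G) (hx'G : x' ∉ G)
    (F : Finset (Finset α))
    (hF : ∀ P ∈ F, P ∈ planes M ∧ P ≠ G ∧
      M.eRk (((insert x (insert x' B)) ∩ P : Finset α) : Set α) = 3 ∧ P ∩ B = L ∩ B ∧ L ⊆ P) :
    ∑ P ∈ F, fRule M P (insert x (insert x' B)) ≤ (6 : ℚ) ^ ((L ∩ B).card - 1) ∧
    (M.eRk ((insert x (insert x' B) : Finset α) : Set α) = 5 →
      ∑ P ∈ F, fRule M P (insert x (insert x' B)) ≤ 2 * (6 : ℚ) ^ ((L ∩ B).card - 2)) := by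
  classical
  have hLcard' : 2 ≤ L.card := hLcard.trans (Finset.card_le_card Finset.inter_subset_left)
  have hrule : ∀ P ∈ F, fRule M P (insert x (insert x' B)) =
      (6 : ℚ) ^ (((insert x (insert x' B)) ∩ P).card - 3) := by
    intro P hP
    unfold fRule
    rw [if_pos (hF P hP).2.2.1]
  have hclP : ∀ P ∈ F, ∀ y ∈ P ∩ {x, x'}, P = clF M (insert y L) := by
    intro P hP y hy
    obtain ⟨hPpl, -, -, -, hLP⟩ := hF P hP
    rw [Finset.mem_inter, Finset.mem_insert, Finset.mem_singleton] at hy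
    rcases hy with ⟨hyP, rfl | rfl⟩
    · exact plane_eq_clF_insert hs hPpl hL hLP hLG hLcard' hx hxG hyP
    · exact plane_eq_clF_insert hs hPpl hL hLP hLG hLcard' hx' hx'G hyP
  have hcardF : ∀ P ∈ F, ((insert x (insert x' B)) ∩ P).card ≤ (L ∩ B).card + (P ∩ {x, x'}).card := by
    intro P hP
    rw [← (hF P hP).2.2.2.1]
    exact pair_trace_card_le P B x x'
  have hmeet : ∀ P ∈ F, (P ∩ {x, x'}).Nonempty := by
    intro P hP
    obtain ⟨hPpl, hne, hr3, -, -⟩ := hF P hP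
    exact pair_meets hG hPpl hne hB hr3
  -- the key dichotomy
  by_cases hboth : ∃ P₀ ∈ F, {x, x'} ⊆ P₀
  · obtain ⟨P₀, hP₀, hsub⟩ := hboth
    -- `F = {P₀}`
    have hF1 : F = {P₀} := by
      rw [Finset.eq_singleton_iff_unique_mem]
      refine ⟨hP₀, ?_⟩
      intro P hP
      obtain ⟨y, hy⟩ := hmeet P hP
      have hyP₀ : y ∈ P₀ ∩ {x, x'} := by
        rw [Finset.mem_inter] at hy ⊢
        exact ⟨hsub hy.2, hy.2⟩
      rw [hclP P hP y hy, hclP P₀ hP₀ y hyP₀]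
    have hcard2 : (P₀ ∩ {x, x'}).card ≤ 2 := by
      calc (P₀ ∩ {x, x'}).card ≤ ({x, x'} : Finset α).card := Finset.card_le_card Finset.inter_subset_right
        _ = 2 := Finset.card_pair hxx'
    refine ⟨?_, ?_⟩
    · rw [hF1, Finset.sum_singleton, hrule P₀ hP₀]
      apply six_pow_le
      have := hcardF P₀ hP₀
      omega
    · -- `ρ(S) = 5` is impossible when a plane contains `L ∪ {x, x′}`
      intro hr5
      exfalso
      obtain ⟨hPpl, -, -, -, hLP⟩ := hF P₀ hP₀
      have hZ : L ∪ {x, x'} ⊆ P₀ := Finset.union_subset hLP hsub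
      have hrZ : M.eRk ((L ∪ {x, x'} : Finset α) : Set α) ≤ 3 := by
        calc M.eRk ((L ∪ {x, x'} : Finset α) : Set α) ≤ M.eRk (P₀ : Set α) :=
              M.eRk_mono (Finset.coe_subset.2 hZ)
          _ = 3 := (mem_planes.1 hPpl).2.2
      have hrBZ : (2 : ℕ∞) ≤ M.eRk ((B ∩ (L ∪ {x, x'}) : Finset α) : Set α) := by
        have hsub2 : L ∩ B ⊆ B ∩ (L ∪ {x, x'}) := by
          intro y hy
          rw [Finset.mem_inter] at hy
          rw [Finset.mem_inter, Finset.mem_union]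
          exact ⟨hy.2, Or.inl hy.1⟩
        have hr2 : M.eRk ((L ∩ B : Finset α) : Set α) = 2 :=
          eRk_eq_two_of_subset_line hs hL Finset.inter_subset_left hLcard
        rw [← hr2]
        exact M.eRk_mono (Finset.coe_subset.2 hsub2)
      have h4 := eRk_union_le_four hrB hrZ hrBZ
      have hSsub : insert x (insert x' B) ⊆ B ∪ (L ∪ {x, x'}) := by
        intro y hy
        rw [Finset.mem_insert, Finset.mem_insert] at hy
        rw [Finset.mem_union, Finset.mem_union, Finset.mem_insert, Finset.mem_singleton]
        rcases hy with rfl | rfl | hyB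
        · exact Or.inr (Or.inr (Or.inl rfl))
        · exact Or.inr (Or.inr (Or.inr rfl))
        · exact Or.inl hyB
      have h5 : M.eRk ((insert x (insert x' B) : Finset α) : Set α) ≤ 4 :=
        (M.eRk_mono (Finset.coe_subset.2 hSsub)).trans h4
      rw [hr5] at h5
      exact absurd h5 (by decide)
  · push Not at hboth
    have hsum := pair_fibre_le_of_no_both hs hG hB hL hLG hLcard hx hx' hxx' hxG hx'G F hF hboth
    refine ⟨?_, fun _ => hsum⟩
    calc ∑ P ∈ F, fRule M P (insert x (insert x' B)) ≤ 2 * (6 : ℚ) ^ ((L ∩ B).card - 2) := hsum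
      _ ≤ (6 : ℚ) ^ ((L ∩ B).card - 1) := by
          have hk : (L ∩ B).card - 1 = ((L ∩ B).card - 2) + 1 := by omega
          rw [hk, pow_succ]
          nlinarith [show (0 : ℚ) ≤ (6 : ℚ) ^ ((L ∩ B).card - 2) by positivity]


end SixThree

end PercRepro
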